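import Mathlib
import Summits.Ventures.HodgeRepro.OcticCMPointGaloisRingTrace

/-!
# OcticCMPointGaloisRingPrimitive — `ψ̃_δ` is a primitive additive character of `GR(4, 4)`

Blind re-derivation cell `pub-hodge-repro`, seat night-2 (gen 4, final cycle).  Target tree path
`lean/Summits/Ventures/HodgeRepro/OcticCMPointGaloisRingPrimitive.lean`.  Third step of the conductor-`2` line at
the inert place `𝔮 | 2`: the additive character `ψ̃_δ(y) = ψ₄(tr(δ y))` of `OcticCMPointGaloisRingTrace.lean` is
**primitive** (`psiTildeGR_isPrimitive`) — for every `a ≠ 0` some `b` has `tr(δ a b) ≠ 0`.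

The argument is the Gram matrix: in the power basis `1, r, r², r³` the bilinear form `(a, b) ↦ tr(δ a b)` has the
matrix `G = !![0,2,0,3; 2,0,3,2; 0,3,2,0; 3,2,0,3]` (`tr_delta_pow`: the seven values `tr(δ r^k)`, `k ≤ 6`, each a
`linear_combination` of the relation and `4 = 0`), `G` is invertible over `ℤ/4` (`G * H = 1` with
`H = !![1,0,0,3; 0,2,3,0; 0,3,0,2; 3,0,2,0]`, `det G = 105 ≡ 1`), so the vector `(tr(δ a r^j))_j = (coords a) ⬝ G`
vanishes only for `a = 0`.

Consequences: `ψ̃_δ(a ·) = ψ̃_δ(b ·)` forces `a = b` (`mulShift_psiTildeGR_injective`), and the `σ`-compatible shifts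
`ψ̃_δ(β ·)` — `ψ̃_δ(β σ x) = ψ̃_δ(β x)` for all `x` — are exactly the trace-zero `β`, `σ(β) = −β`
(`mulShift_conjGR_iff`; at conductor `1` the condition was `β ∈ 𝔽₄`, `OcticCMPointInertModel.mulShift_conj_iff`).

**What this is not.**  The unit group of `GR(4, 4)` and the conductor-`2` Gauss sums at `𝔮` are NOT here.  Nothing
here says anything about the status of the Hodge conjecture for CM abelian varieties, which is NOT proved.
-/

set_option autoImplicit false

noncomputable section

open Polynomial Matrix

namespace Summit.Ventures.HodgeRepro.PeriodCloser

namespace GaloisRing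

/-! ### The power basis indexed by `Fin 4` -/

/-- The basis `1, r, r², r³` of `GR(4, 4)`, indexed by `Fin 4`. -/
def b4 : Module.Basis (Fin 4) (ZMod 4) GR44 := pb.basis.reindex (finCongr pb_dim)

/-- `b4 i = r ^ i`. -/
theorem b4_apply (i : Fin 4) : b4 i = r ^ (i : ℕ) := by
  rw [b4, Module.Basis.reindex_apply, pb_basis_apply]
  rfl

/-- `tr y = 3 · (the `r³`-coordinate of `y` in `b4`)`. -/
theorem tr_apply_b4 (y : GR44) : tr y = 3 * b4.repr y 3 := by
  rw [tr_apply, b4, Module.Basis.repr_reindex_apply]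
  rfl

/-! ### The values `tr(δ r^k)`, `k ≤ 6` -/

/-- `tr (c₀ • 1 + c₁ • r + c₂ • r² + c₃ • r³) = 3 c₃`. -/
theorem tr_comb (c₀ c₁ c₂ c₃ : ZMod 4) :
    tr (c₀ • (1 : GR44) + c₁ • r + c₂ • r ^ 2 + c₃ • r ^ 3) = 3 * c₃ := by
  rw [tr_add, tr_add, tr_add, tr_smul, tr_smul, tr_smul, tr_smul, tr_one, tr_r, tr_r_sq, tr_r_cube]
  ring

/-- `(c : ℤ/4) • y = c * y` for a numeral `c` (as elements of `GR(4, 4)`). -/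
theorem smul_eq_num (c : ZMod 4) (y : GR44) : c • y = algebraMap (ZMod 4) GR44 c * y := Algebra.smul_def c y

/-- **The seven values `tr(δ r^k)`, `k = 0, …, 6`**: `0, 2, 0, 3, 2, 0, 3`. -/
theorem tr_delta_pow (k : ℕ) (hk : k ≤ 6) :
    tr (delta * r ^ k) = ![0, 2, 0, 3, 2, 0, 3] ⟨k, by omega⟩ := by
  have hrel := r_rel
  have h4 := four_eq_zero
  have h2 : algebraMap (ZMod 4) GR44 2 = 2 := map_ofNat _ _
  have h3 : algebraMap (ZMod 4) GR44 3 = 3 := map_ofNat _ _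
  interval_cases k
  · -- δ = 1 + 2 r²
    rw [show delta * r ^ 0 = (1 : ZMod 4) • (1 : GR44) + (0 : ZMod 4) • r + (2 : ZMod 4) • r ^ 2 + (0 : ZMod 4) • r ^ 3 by
      simp only [smul_eq_num, h2, map_zero, map_one]; unfold delta; ring]
    rw [tr_comb]; rfl
  · rw [show delta * r ^ 1 = (0 : ZMod 4) • (1 : GR44) + (1 : ZMod 4) • r + (0 : ZMod 4) • r ^ 2 + (2 : ZMod 4) • r ^ 3 by
      simp only [smul_eq_num, h2, map_zero, map_one]; unfold delta; ring]
    rw [tr_comb]; rfl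
  · rw [show delta * r ^ 2 = (2 : ZMod 4) • (1 : GR44) + (2 : ZMod 4) • r + (1 : ZMod 4) • r ^ 2 + (0 : ZMod 4) • r ^ 3 by
      simp only [smul_eq_num, h2, map_zero, map_one]; unfold delta
      linear_combination (2 : GR44) * hrel + (-1 - 2 * r - r ^ 2) * h4]
    rw [tr_comb]; rfl
  · rw [show delta * r ^ 3 = (0 : ZMod 4) • (1 : GR44) + (2 : ZMod 4) • r + (2 : ZMod 4) • r ^ 2 + (1 : ZMod 4) • r ^ 3 by
      simp only [smul_eq_num, h2, map_zero, map_one]; unfold delta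
      linear_combination (2 * r) * hrel + (-r - 2 * r ^ 2 - r ^ 3) * h4]
    rw [tr_comb]; rfl
  · rw [show delta * r ^ 4 = (3 : ZMod 4) • (1 : GR44) + (1 : ZMod 4) • r + (0 : ZMod 4) • r ^ 2 + (2 : ZMod 4) • r ^ 3 by
      simp only [smul_eq_num, h2, h3, map_zero, map_one]; unfold delta
      linear_combination (-3 + 2 * r ^ 2) * hrel + (2 * r + r ^ 2 - 2 * r ^ 3) * h4]
    rw [tr_comb]; rfl
  · rw [show delta * r ^ 5 = (2 : ZMod 4) • (1 : GR44) + (1 : ZMod 4) • r + (1 : ZMod 4) • r ^ 2 + (0 : ZMod 4) • r ^ 3 by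
      simp only [smul_eq_num, h2, map_zero, map_one]; unfold delta
      linear_combination (-6 - 3 * r + 2 * r ^ 3) * hrel + (1 + 5 * r + 5 * r ^ 2 + r ^ 3) * h4]
    rw [tr_comb]; rfl
  · rw [show delta * r ^ 6 = (0 : ZMod 4) • (1 : GR44) + (2 : ZMod 4) • r + (1 : ZMod 4) • r ^ 2 + (1 : ZMod 4) • r ^ 3 by
      simp only [smul_eq_num, h2, map_zero, map_one]; unfold delta
      linear_combination (4 - 6 * r - 3 * r ^ 2 + 2 * r ^ 4) * hrel + (-1 - 2 * r + 3 * r ^ 2 + 5 * r ^ 3) * h4]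
    rw [tr_comb]; rfl

/-! ### The Gram matrix and its inverse -/

/-- The Gram matrix `G i j = tr(δ r^i r^j)` of the trace form in the basis `1, r, r², r³`. -/
def G : Matrix (Fin 4) (Fin 4) (ZMod 4) := !![0, 2, 0, 3; 2, 0, 3, 2; 0, 3, 2, 0; 3, 2, 0, 3]

/-- The inverse of `G` over `ℤ/4`. -/
def H : Matrix (Fin 4) (Fin 4) (ZMod 4) := !![1, 0, 0, 3; 0, 2, 3, 0; 0, 3, 0, 2; 3, 0, 2, 0]

/-- **`G * H = 1`**: `G` is invertible over `ℤ/4`. -/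
theorem G_mul_H : G * H = 1 := by
  ext i j
  fin_cases i <;> fin_cases j <;> simp [G, H, Matrix.mul_apply, Fin.sum_univ_four] <;> decide

/-- **`G` is the Gram matrix**: `tr(δ r^i r^j) = G i j`. -/
theorem tr_delta_mul (i j : Fin 4) : tr (delta * r ^ (i : ℕ) * r ^ (j : ℕ)) = G i j := by
  rw [mul_assoc, ← pow_add, tr_delta_pow _ (by omega)]
  fin_cases i <;> fin_cases j <;> rfl

/-- `tr(δ a r^j) = Σ_i (coords a)_i · G i j`. -/
theorem tr_delta_mul_eq_vecMul (a : GR44) (j : Fin 4) :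
    tr (delta * a * r ^ (j : ℕ)) = Matrix.vecMul (⇑(b4.repr a)) G j := by
  conv_lhs => rw [← b4.sum_repr a]
  simp only [b4_apply, Finset.mul_sum, Finset.sum_mul, mul_smul_comm, smul_mul_assoc]
  show trL _ = _
  rw [map_sum]
  simp only [map_smul, smul_eq_mul]
  rw [Matrix.vecMul, dotProduct]
  refine Finset.sum_congr rfl fun i _ => ?_
  rw [show trL (delta * r ^ (i : ℕ) * r ^ (j : ℕ)) = tr (delta * r ^ (i : ℕ) * r ^ (j : ℕ)) from rfl, tr_delta_mul]

/-- **The trace form is non-degenerate**: `a ≠ 0 → ∃ j, tr(δ a r^j) ≠ 0`. -/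
theorem exists_tr_delta_ne_zero {a : GR44} (ha : a ≠ 0) : ∃ j : Fin 4, tr (delta * a * r ^ (j : ℕ)) ≠ 0 := by
  by_contra hcon
  have hcon' : ∀ j : Fin 4, tr (delta * a * r ^ (j : ℕ)) = 0 := fun j => by
    by_contra hj
    exact hcon ⟨j, hj⟩
  have hv : Matrix.vecMul (⇑(b4.repr a)) G = 0 := by
    funext j
    rw [← tr_delta_mul_eq_vecMul, hcon' j]
    rfl
  have hc : ⇑(b4.repr a) = 0 := by
    calc ⇑(b4.repr a) = Matrix.vecMul (⇑(b4.repr a)) 1 := (Matrix.vecMul_one _).symm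
      _ = Matrix.vecMul (⇑(b4.repr a)) (G * H) := by rw [G_mul_H]
      _ = Matrix.vecMul (Matrix.vecMul (⇑(b4.repr a)) G) H := (Matrix.vecMul_vecMul _ _ _).symm
      _ = 0 := by rw [hv, Matrix.zero_vecMul]
  apply ha
  have : b4.repr a = 0 := DFunLike.coe_injective hc
  exact b4.repr.injective (by rw [this, map_zero])

/-! ### Primitivity -/

/-- `ψ₄ t = 1 ↔ t = 0`. -/
theorem psi4_eq_one_iff (t : ZMod 4) : psi4 t = 1 ↔ t = 0 := by
  unfold psi4
  rw [AddChar.zmodChar_apply]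
  fin_cases t
  · show Complex.I ^ (0 : ZMod 4).val = 1 ↔ (0 : ZMod 4) = 0
    simp
  · show Complex.I ^ (1 : ZMod 4).val = 1 ↔ (1 : ZMod 4) = 0
    rw [show (1 : ZMod 4).val = 1 from rfl, pow_one]
    refine ⟨fun h => ?_, fun h => absurd h (by decide)⟩
    have := congrArg Complex.im h
    simp at this
  · show Complex.I ^ (2 : ZMod 4).val = 1 ↔ (2 : ZMod 4) = 0
    rw [show (2 : ZMod 4).val = 2 from rfl, Complex.I_sq]
    exact ⟨fun h => by norm_num at h, fun h => absurd h (by decide)⟩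
  · show Complex.I ^ (3 : ZMod 4).val = 1 ↔ (3 : ZMod 4) = 0
    rw [show (3 : ZMod 4).val = 3 from rfl, pow_succ, Complex.I_sq]
    refine ⟨fun h => ?_, fun h => absurd h (by decide)⟩
    have := congrArg Complex.im h
    simp at this

/-- **`ψ̃_δ` is primitive**: for `a ≠ 0`, `ψ̃_δ(a ·) ≠ 1` — witnessed by some `b = r^j` with `tr(δ a r^j) ≠ 0`. -/
theorem psiTildeGR_isPrimitive : psiTildeGR.IsPrimitive := by
  intro a ha h1
  obtain ⟨j, hj⟩ := exists_tr_delta_ne_zero ha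
  have := DFunLike.congr_fun h1 (r ^ (j : ℕ))
  rw [AddChar.mulShift_apply, AddChar.one_apply, psiTildeGR_apply, psi4_eq_one_iff, ← mul_assoc] at this
  exact hj this

/-! ### Consequences of primitivity: `ψ̃_δ(a ·) = ψ̃_δ(b ·)` forces `a = b`; the `σ`-compatible shifts -/

/-- `ψ̃_δ(a ·) = ψ̃_δ(b ·)` (as characters) forces `a = b`. -/
theorem mulShift_psiTildeGR_injective {a b : GR44}
    (h : AddChar.mulShift psiTildeGR a = AddChar.mulShift psiTildeGR b) : a = b := by
  by_contra hne
  apply psiTildeGR_isPrimitive (sub_ne_zero.2 hne)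
  have : AddChar.mulShift psiTildeGR (a - b) = AddChar.mulShift psiTildeGR a * AddChar.mulShift psiTildeGR (-b) := by
    rw [AddChar.mulShift_mul, sub_eq_add_neg]
  rw [this, h, AddChar.mulShift_mul, add_neg_cancel, AddChar.mulShift_zero]

/-- **The `σ`-compatible shifts of `ψ̃_δ` are the trace-zero `β`**: `ψ̃_δ(β σ(x)) = ψ̃_δ(β x)` for all `x` iff
`σ(β) = −β` (at conductor `2`; compare `OcticCMPointInertModel.mulShift_conj_iff` at conductor `1`, where the
condition was `β ∈ 𝔽₄`). -/
theorem mulShift_conjGR_iff (β : GR44) :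
    (∀ x, psiTildeGR (β * conjGR x) = psiTildeGR (β * x)) ↔ conjGR β = -β := by
  constructor
  · intro h
    -- `ψ̃_δ(β σ x) = ψ̃_δ(σ(σ(β) x)) = ψ̃_δ(−σ(β) x)`, so `ψ̃_δ((−σ β) ·) = ψ̃_δ(β ·)` and `−σ β = β`
    have key : AddChar.mulShift psiTildeGR (-(conjGR β)) = AddChar.mulShift psiTildeGR β := by
      ext x
      rw [AddChar.mulShift_apply, AddChar.mulShift_apply, ← h x]
      have : β * conjGR x = conjGR (conjGR β * x) := by
        rw [map_mul, conjGR_conjGR]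
      rw [this, psiTildeGR_conjGR, neg_mul]
    exact neg_eq_iff_eq_neg.1 (mulShift_psiTildeGR_injective key)
  · intro h x
    have : β * conjGR x = conjGR (conjGR β * x) := by
      rw [map_mul, conjGR_conjGR]
    rw [this, psiTildeGR_conjGR, h, neg_mul, neg_neg]

end GaloisRing

end Summit.Ventures.HodgeRepro.PeriodCloser

end
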